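import Literature.NumberTheory.NumberFields.KummerPlusMinusRankRadical
import HarnessLib

/-!
# Lang's Theorem 2.1 with ramification at `p` allowed — I: the ideal of a Kummer radical all of whose prime
# exponents are divisible by `p`, and the quadratic lift unramified AWAY from a given prime
# (Lang, *Cyclotomic Fields I and II*, Ch. 13 §2, proof of Thm. 2.1; Greenberg, LNM 1716, proof of Lemma 5.9)

Topic `NumberTheory/NumberFields`; namespaces `Literature.NumberTheory.NumberFields.QuadraticLift` and
`Literature.NumberTheory.NumberFields.KummerRank` (as the files being generalised).  Theorem-only file (no
definition, no named fact, no `sorry`), unconditional.  Written by the prover seat `bsd-eis-lam-a` g20 (cell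
`bsd-eis`, `--supports` stmt-BirchSwinnertonDyer-19035: crux 5 `MazurMCOnX1RankZero`, registered stub
`stub_publishedL59` = Greenberg's Lemma 5.9, whose printed proof is «Ferrero–Washington + the Kummer/reflection
bookkeeping» — this file and its sequel supply the reflection bookkeeping for abelian `p`-extensions of a totally
real field that are unramified OUTSIDE `p` only).

The tree's `KummerPlusMinusRankRadical.lean` (`KummerRank.exists_ideal_of_radical`) and
`AbelianUnramifiedLiftToQuadratic.lean` (`QuadraticLift.isUnramifiedIn_of_finrank_eq_prime_pow`) are written
for an extension `E₁/K⁺` unramified at EVERY finite prime (the Hilbert `p`-class field).  In Greenberg's Lemma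
5.9 the relevant extensions of the real field are unramified only at the primes not above `p`; the two inputs
are generalised accordingly, with the SAME proofs:

* `QuadraticLift.isUnramifiedIn_of_finrank_eq_prime_pow_of_notMem` — `[K:F] = 2`, `E/F` Galois of degree `p^r`
  (`p` odd) unramified at the finite primes of `F` not containing the natural number `q`; then the lift
  `M = K₁E` is unramified over `K` at every finite prime of `K` not containing `q` (the original argument is
  prime-by-prime: `e(𝔓|K) ∣ p^r` and `e(𝔓|K) ≤ e(𝔓 ∩ E|F)·e(𝔓|E) = e(𝔓|E) ≤ 2`).
* `KummerRank.exists_ideal_of_radical_of_dvd_count` — for the abelian lift `M = K E₁` of a CM field `K ∋ ζ_p`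
  and an integral radical `α ∈ 𝓞_M`, `α^p = β ∈ 𝓞_K ∖ 0`, such that EVERY prime exponent of `(β)` is divisible
  by `p` (in the original this is derived from «`M/K` unramified everywhere»; here it is the hypothesis, to be
  supplied away from `p` by unramifiedness and above `p` by restricting to a subgroup of radicals of index
  `≤ p^{#{𝔭 ∣ p}}`): `(β) = 𝔟^p`, `𝔟 𝔟̄ = (c')`, `c'^p = β β̄`, `N_{K/K⁺}[𝔟] = 1`, `[𝔟]^p = 1`.

## References

* S. Lang, *Cyclotomic Fields I and II*, GTM 121 (1990), Ch. 13 §2, Thm. 2.1 and its proof (pp. 199–200). [Lang1990]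
* R. Greenberg, *Iwasawa theory for elliptic curves*, LNM 1716 (1999), Lemma 5.9 and its proof (pp. 142–144 of
  the Cetraro volume). [GreenbergLNM1716]
* J. Neukirch, *Algebraic Number Theory* (1999), Ch. I §3 Thm. (3.3), §8 Prop. (8.2); Ch. II §7 Prop. (7.2).
  [NeukirchANT1999]
-/

noncomputable section

open NumberField NumberField.IsCMField IsDedekindDomain Module IntermediateField
open scoped nonZeroDivisors

namespace Literature.NumberTheory.NumberFields

section IdealLemmas

/-- `I ^ n = J ^ n` with `n ≠ 0` forces `I = J` for ideals of a Dedekind domain (unique factorisation: the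
multiplicities of every prime agree; private copy of the helper of `KummerPlusMinusRankRadical.lean`).
[cite: NeukirchANT1999, Ch. I §3 Thm. (3.3)] -/
private theorem ideal_eq_of_pow_eq_pow_of_ne_zero' {R : Type*} [CommRing R] [IsDedekindDomain R]
    {I J : Ideal R} {n : ℕ} (hn : n ≠ 0) (h : I ^ n = J ^ n) : I = J := by
  classical
  have hzero : ∀ {I J : Ideal R}, I ^ n = J ^ n → I = ⊥ → J = ⊥ := by
    intro I J h hI
    rw [hI, ← Ideal.zero_eq_bot, zero_pow hn] at h
    rw [← Ideal.zero_eq_bot]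
    exact pow_eq_zero_iff hn |>.mp h.symm
  by_cases hI : I = ⊥
  · rw [hI, hzero h hI]
  have hJ : J ≠ ⊥ := fun hJ => hI (hzero h.symm hJ)
  have hf := congrArg UniqueFactorizationMonoid.normalizedFactors h
  rw [UniqueFactorizationMonoid.normalizedFactors_pow,
    UniqueFactorizationMonoid.normalizedFactors_pow] at hf
  have hf' : UniqueFactorizationMonoid.normalizedFactors I =
      UniqueFactorizationMonoid.normalizedFactors J := by
    ext q
    have := congrArg (Multiset.count q) hf
    simp only [Multiset.count_nsmul] at this
    exact Nat.eq_of_mul_eq_mul_left (Nat.pos_of_ne_zero hn) this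
  rw [← Ideal.prod_normalizedFactors_eq_self hI, ← Ideal.prod_normalizedFactors_eq_self hJ, hf']

end IdealLemmas

/-! ## §1 The quadratic lift is unramified away from `q` -/

namespace QuadraticLift

variable {F K : Type} [Field F] [Field K] [Algebra F K]

/-- **Unramified base change for `p`-power degree, AWAY FROM A PRIME.**  `[K:F] = 2`, `E/F` Galois of degree
`p^r` with `p` an odd prime, unramified at every finite prime of `F` not containing the natural number `q`; then
`M = K₁E` is unramified over `K` at every finite prime of `K` not containing `q`: for a prime `𝔓` of `M` over such
a prime, `𝔓 ∩ F ∌ q`, `e(𝔓|K) ∣ [M:K] = p^r` while `e(𝔓|K) ≤ e(𝔓|F) = e(𝔓 ∩ E|F)·e(𝔓|E) = e(𝔓|E) ≤ [M:E] = 2`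
(the proof of `QuadraticLift.isUnramifiedIn_of_finrank_eq_prime_pow`, prime by prime).
[cite: NeukirchANT1999, Ch. II §7 Prop. (7.2)] [cite: Lang1990, Ch. 13 §2, Thm. 2.1 (proof: "`K_∞ = K K_∞⁺`")] -/
theorem isUnramifiedIn_of_finrank_eq_prime_pow_of_notMem {E : IntermediateField F (AlgebraicClosure K)}
    {M : IntermediateField K (AlgebraicClosure K)}
    (hM : M.restrictScalars F =
      (IsScalarTower.toAlgHom F K (AlgebraicClosure K)).fieldRange ⊔ E)
    [NumberField F] [NumberField K] [FiniteDimensional F E] [IsGalois F E]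
    (h2 : finrank F K = 2) {p r : ℕ} (hp : p.Prime) (hp2 : p ≠ 2) (hpE : finrank F E = p ^ r) (q : ℕ)
    (hunr : ∀ v : HeightOneSpectrum (𝓞 F), ((q : ℕ) : 𝓞 F) ∉ v.asIdeal →
      Algebra.IsUnramifiedIn (𝓞 E) v.asIdeal) :
    ∀ v : HeightOneSpectrum (𝓞 K), ((q : ℕ) : 𝓞 K) ∉ v.asIdeal →
      Algebra.IsUnramifiedIn (𝓞 M) v.asIdeal := by
  classical
  haveI : FiniteDimensional F K := Module.finite_of_finrank_eq_succ h2
  haveI : Normal F K := by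
    haveI : Algebra.IsQuadraticExtension F K := ⟨h2⟩
    infer_instance
  haveI := finiteDimensional hM
  haveI := isGalois hM
  haveI : NumberField E := NumberField.of_module_finite F E
  haveI : NumberField M := NumberField.of_module_finite K M
  have hcop : Nat.Coprime (finrank F K) (finrank F E) := by
    rw [h2, hpE]
    exact Nat.Coprime.pow_right _ ((Nat.coprime_primes Nat.prime_two hp).mpr (Ne.symm hp2))
  have hKM : finrank K M = p ^ r := (finrank_eq hM hcop).trans hpE
  -- the inclusion `E → M` as an algebra
  let f : E →ₐ[F] M :=
    { toFun := fun x => ⟨x, mem_of_mem hM x.2⟩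
      map_one' := rfl
      map_mul' := fun _ _ => rfl
      map_zero' := rfl
      map_add' := fun _ _ => rfl
      commutes' := fun _ => rfl }
  letI : Algebra E M := f.toRingHom.toAlgebra
  haveI : IsScalarTower F E M := IsScalarTower.of_algebraMap_eq fun _ => rfl
  haveI : Module.Finite E M := Module.Finite.of_restrictScalars_finite F E M
  haveI : Module.Free E M := Module.Free.of_divisionRing E M
  haveI : Module.Free F E := Module.Free.of_divisionRing F E
  have hEM : finrank E M = 2 := by
    have h := Module.finrank_mul_finrank F E M
    have hFM : finrank F M = 2 * p ^ r := by
      rw [← Module.finrank_mul_finrank F K M, h2, hKM]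
    rw [hFM, hpE, mul_comm] at h
    exact Nat.eq_of_mul_eq_mul_right (pow_pos hp.pos r) h
  intro v hqv
  rw [Algebra.isUnramifiedIn_iff_forall_ramificationIdx_eq_one]
  intro P hP hPv
  haveI := hP
  have hP0 : P ≠ ⊥ := Ideal.ne_bot_of_liesOver_of_ne_bot v.ne_bot P
  haveI : P.IsMaximal := hP.isMaximal hP0
  haveI : (P.under (𝓞 E)).IsMaximal := Ideal.IsMaximal.under (𝓞 E) P
  haveI : (P.under (𝓞 F)).IsMaximal := Ideal.IsMaximal.under (𝓞 F) P
  haveI : (P.under (𝓞 K)).IsMaximal := Ideal.IsMaximal.under (𝓞 K) P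
  have hF0 : P.under (𝓞 F) ≠ ⊥ := mt Ideal.eq_bot_of_comap_eq_bot hP0
  -- `𝔓 ∩ F ∌ q` (as `𝔓 ∩ K = v ∌ q`)
  have hqF : ((q : ℕ) : 𝓞 F) ∉ P.under (𝓞 F) := by
    intro h
    apply hqv
    rw [hPv.over, Ideal.under_def, Ideal.mem_comap, map_natCast]
    rw [Ideal.under_def, Ideal.mem_comap, map_natCast] at h
    exact h
  -- `e(𝔓|K) ∣ p ^ r`
  have hdvd : P.ramificationIdx (𝓞 K) ∣ p ^ r := hKM ▸ ramificationIdx_dvd_finrank P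
  -- `e(𝔓 ∩ E | F) = 1`
  have h1 : (P.under (𝓞 E)).ramificationIdx (𝓞 F) = 1 := by
    let w : HeightOneSpectrum (𝓞 F) := ⟨P.under (𝓞 F), inferInstance, hF0⟩
    haveI : Algebra.IsUnramifiedAt (𝓞 F) (P.under (𝓞 E)) :=
      hunr w hqF (P.under (𝓞 E)) inferInstance ⟨(Ideal.under_under (B := 𝓞 E) P).symm⟩
    exact Ideal.ramificationIdx_eq_one _ _
  -- `e(𝔓|E) ≤ 2`
  haveI : NoZeroSMulDivisors (𝓞 E) (𝓞 M) := ⟨fun {c z} h => by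
    rw [Algebra.smul_def, mul_eq_zero] at h
    exact h.imp_left fun hc => RingOfIntegers.algebraMap.injective E M (by rw [hc, map_zero])⟩
  have h2' : P.ramificationIdx (𝓞 E) ≤ 2 := by
    have h := Ideal.ramificationIdx_le_finrank (𝓞 M) E M P (p := P.under (𝓞 E))
    rw [Ideal.ramificationIdx'_eq_ramificationIdx (P.under (𝓞 E)) P
      (mt Ideal.eq_bot_of_comap_eq_bot hP0 : P.under (𝓞 E) ≠ ⊥), hEM] at h
    exact h
  -- multiplicativity in the towers `F ⊆ E ⊆ M` and `F ⊆ K ⊆ M`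
  have htE : P.ramificationIdx (𝓞 F) =
      (P.under (𝓞 E)).ramificationIdx (𝓞 F) * P.ramificationIdx (𝓞 E) :=
    Ideal.ramificationIdx_tower (R := 𝓞 F) (P.under (𝓞 E)) P
  have htK : P.ramificationIdx (𝓞 F) =
      (P.under (𝓞 K)).ramificationIdx (𝓞 F) * P.ramificationIdx (𝓞 K) :=
    Ideal.ramificationIdx_tower (R := 𝓞 F) (P.under (𝓞 K)) P
  have hposK : 0 < (P.under (𝓞 K)).ramificationIdx (𝓞 F) := Ideal.ramificationIdx_pos _ _
  have hle : P.ramificationIdx (𝓞 K) ≤ 2 := by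
    have : P.ramificationIdx (𝓞 K) ≤ P.ramificationIdx (𝓞 F) := by
      rw [htK]; exact Nat.le_mul_of_pos_left _ hposK
    rw [h1, one_mul] at htE
    omega
  obtain ⟨j, -, hj⟩ := (Nat.dvd_prime_pow hp).mp hdvd
  rw [hj] at hle ⊢
  rcases Nat.eq_zero_or_pos j with hj0 | hj0
  · rw [hj0, pow_zero]
  · exfalso
    have h3 : 3 ≤ p := by have := hp.two_le; omega
    have : p ≤ p ^ j := Nat.le_self_pow hj0.ne' p
    omega

end QuadraticLift

/-! ## §2 The ideal of a radical with `p`-divisible prime exponents -/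

section Radical

variable (K : Type) [Field K] [NumberField K] [IsCMField K]

/-- **The ideal `𝔟` of a Kummer radical whose prime exponents are all divisible by `p`.**  For an abelian lift
`M = K E₁` of a CM field `K ∋ ζ_p` (`p` odd), a lift `g` of complex conjugation, and `α ∈ 𝓞_M` with
`α^p = β ∈ 𝓞_K ∖ 0` such that `p ∣ v(β)` for EVERY prime `v` of `𝓞_K`: there are `𝔟` and `c'` with
`(β) = 𝔟^p`, `𝔟 𝔟̄ = (c')`, `c'^p = β β̄`, `N_{K/K⁺}[𝔟] = 1` and `[𝔟]^p = 1` — steps §C–§E of Lang's proof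
(`KummerRank.exists_ideal_of_radical`, whose hypothesis «`M/K` unramified at the finite primes» enters only to
produce the divisibility of the exponents, `dvd_count_of_eq_pow_of_isUnramifiedIn`).
[cite: Lang1990, Ch. 13 §2, Thm. 2.1 (proof: "there exists an ideal `𝔟` of `K` such that `(b) = 𝔟^p`")]
[cite: GreenbergLNM1716, §5 Lemma 5.9 (proof, pp. 143–144)] -/
theorem KummerRank.exists_ideal_of_radical_of_dvd_count {p : ℕ} (hp : p.Prime) (hp2 : p ≠ 2) {ζ : K}
    (hζ : IsPrimitiveRoot ζ p)
    {E₁ : IntermediateField (maximalRealSubfield K) (AlgebraicClosure K)}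
    {M : IntermediateField K (AlgebraicClosure K)}
    (hM : M.restrictScalars (maximalRealSubfield K) =
      (IsScalarTower.toAlgHom (maximalRealSubfield K) K (AlgebraicClosure K)).fieldRange ⊔ E₁)
    [Normal (maximalRealSubfield K) E₁] [IsMulCommutative (E₁ ≃ₐ[maximalRealSubfield K] E₁)]
    [FiniteDimensional K M] [IsGalois K M] [NumberField M]
    (g : AlgebraicClosure K ≃ₐ[maximalRealSubfield K] AlgebraicClosure K)
    (hg : ∀ x : K, g (algebraMap K (AlgebraicClosure K) x) =
      algebraMap K (AlgebraicClosure K) (complexConj K x))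
    {α : 𝓞 M} {β : 𝓞 K} (hβ0 : β ≠ 0) (hαβ : algebraMap (𝓞 K) (𝓞 M) β = α ^ p)
    (hdvd : ∀ v : HeightOneSpectrum (𝓞 K),
      p ∣ (Associates.mk v.asIdeal).count (Associates.mk (Ideal.span {β})).factors) :
    ∃ (𝔟 : Ideal (𝓞 K)) (c' : 𝓞 K) (h𝔟mem : 𝔟 ∈ (Ideal (𝓞 K))⁰),
      Ideal.span {β} = 𝔟 ^ p ∧ 𝔟 ≠ ⊥ ∧
      𝔟 * 𝔟.map (AmbiguousClass.intAut (complexConj K) : 𝓞 K →+* 𝓞 K) = Ideal.span {c'} ∧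
      c' ^ p = β * AmbiguousClass.intAut (complexConj K) β ∧
      classGroupNorm (maximalRealSubfield K) K (ClassGroup.mk0 ⟨𝔟, h𝔟mem⟩) = 1 ∧
      ClassGroup.mk0 ⟨𝔟, h𝔟mem⟩ ^ p = 1 := by
  classical
  haveI : Fact p.Prime := ⟨hp⟩
  have h2 : finrank (maximalRealSubfield K) K = 2 :=
    (IsCMField.isQuadraticExtension K).finrank_eq_two
  haveI : FiniteDimensional (maximalRealSubfield K) K := Module.finite_of_finrank_eq_succ h2
  have hαβM : algebraMap K M (β : K) = (α : M) ^ p := by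
    have h1 := congrArg (fun z : 𝓞 M => (z : M)) hαβ
    simp only [RingOfIntegers.coe_eq_algebraMap, map_pow] at h1
    rw [← IsScalarTower.algebraMap_apply (𝓞 K) (𝓞 M) M β,
      IsScalarTower.algebraMap_apply (𝓞 K) K M β] at h1
    exact h1
  have hαβΩ : ((α : M) : AlgebraicClosure K) ^ p = algebraMap K (AlgebraicClosure K) (β : K) := by
    rw [IsScalarTower.algebraMap_apply K M (AlgebraicClosure K), hαβM]
    rfl
  obtain ⟨c, hc⟩ := IsCMField.mul_conjLift_mem_range_of_isMulCommutative K hp hζ hM g hg hαβΩ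
  -- `c` is integral
  have hαint : IsIntegral ℤ ((α : M) : AlgebraicClosure K) := α.isIntegral_coe.algebraMap
  have hcint : IsIntegral ℤ c := by
    apply (isIntegral_algebraMap_iff
      (FaithfulSMul.algebraMap_injective K (AlgebraicClosure K))).mp
    rw [hc]
    exact hαint.mul (map_isIntegral_int g hαint)
  obtain ⟨c', hc'⟩ : ∃ c' : 𝓞 K, (c' : K) = c := ⟨⟨c, hcint⟩, rfl⟩
  -- `c ^ p = β β̄`, in `K` and in `𝓞 K`
  have hkeyK : (c : K) ^ p = (β : K) * complexConj K β := by
    apply FaithfulSMul.algebraMap_injective K (AlgebraicClosure K)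
    rw [map_pow, hc, mul_pow, hαβΩ, ← map_pow, hαβΩ, hg, ← map_mul]
  have hβK : (β : K) ≠ 0 := RingOfIntegers.coe_ne_zero_iff.mpr hβ0
  have hc0 : c' ≠ 0 := by
    intro h0
    have hc0' : c = 0 := by rw [← hc', h0]; rfl
    rw [hc0', zero_pow hp.ne_zero, zero_eq_mul] at hkeyK
    rcases hkeyK with h | h
    · exact hβK h
    · exact hβK ((map_eq_zero _).mp h)
  have hkey : c' ^ p = β * AmbiguousClass.intAut (complexConj K) β := by
    apply RingOfIntegers.ext
    simp only [map_pow, map_mul]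
    rw [show algebraMap (𝓞 K) K c' = c from hc']
    exact hkeyK
  -- `(β) = 𝔟^p`, `(β̄) = 𝔟̄^p`, `𝔟 𝔟̄ = (c')`
  obtain ⟨𝔟, h𝔟⟩ := exists_span_eq_pow_of_forall_count_dvd hβ0 (n := p) hdvd
  have h𝔟σ : Ideal.span {AmbiguousClass.intAut (complexConj K) β} =
      (𝔟.map (AmbiguousClass.intAut (complexConj K) : 𝓞 K →+* 𝓞 K)) ^ p := by
    have := congrArg (Ideal.map (AmbiguousClass.intAut (complexConj K) : 𝓞 K →+* 𝓞 K)) h𝔟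
    rwa [Ideal.map_span, Set.image_singleton, Ideal.map_pow] at this
  have hprod : (𝔟 * 𝔟.map (AmbiguousClass.intAut (complexConj K) : 𝓞 K →+* 𝓞 K)) ^ p =
      Ideal.span {c'} ^ p := by
    rw [mul_pow, ← h𝔟, ← h𝔟σ, Ideal.span_singleton_mul_span_singleton, Ideal.span_singleton_pow,
      hkey]
  have h𝔟𝔟 : 𝔟 * 𝔟.map (AmbiguousClass.intAut (complexConj K) : 𝓞 K →+* 𝓞 K) =
      Ideal.span {c'} :=
    ideal_eq_of_pow_eq_pow_of_ne_zero' hp.ne_zero hprod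
  have h𝔟0 : 𝔟 ≠ ⊥ := by
    intro h0
    rw [h0, ← Ideal.zero_eq_bot, zero_pow hp.ne_zero, Ideal.zero_eq_bot,
      Ideal.span_singleton_eq_bot] at h𝔟
    exact hβ0 h𝔟
  have h𝔟mem : 𝔟 ∈ (Ideal (𝓞 K))⁰ := mem_nonZeroDivisors_of_ne_zero (by simpa using h𝔟0)
  -- the class `x = [𝔟]`: `x^p = 1`, `i(N x) = [𝔟 𝔟̄] = 1`, hence `N x = 1`
  have hxp : ClassGroup.mk0 ⟨𝔟, h𝔟mem⟩ ^ p = 1 := by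
    have hmem : 𝔟 ^ p ∈ (Ideal (𝓞 K))⁰ := pow_mem h𝔟mem p
    rw [← map_pow, show (⟨𝔟, h𝔟mem⟩ ^ p : (Ideal (𝓞 K))⁰) = ⟨𝔟 ^ p, hmem⟩ from rfl]
    exact (ClassGroup.mk0_eq_one_iff hmem).mpr ⟨⟨β, h𝔟.symm⟩⟩
  have hiN : classGroupExtend (maximalRealSubfield K) K
      (classGroupNorm (maximalRealSubfield K) K (ClassGroup.mk0 ⟨𝔟, h𝔟mem⟩)) = 1 := by
    have hmem : 𝔟 * 𝔟.map (AmbiguousClass.intAut (complexConj K) : 𝓞 K →+* 𝓞 K) ∈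
        (Ideal (𝓞 K))⁰ := by
      rw [h𝔟𝔟]
      refine mem_nonZeroDivisors_of_ne_zero ?_
      rw [Ne, Submodule.zero_eq_bot, Ideal.span_singleton_eq_bot]
      exact hc0
    rw [IsCMField.classGroupExtend_classGroupNorm, AmbiguousClass.mulEquiv_mk0, ← map_mul,
      show ((⟨𝔟, h𝔟mem⟩ : (Ideal (𝓞 K))⁰) * ⟨_, AmbiguousClass.map_mem_nonZeroDivisors
        (complexConj K) ⟨𝔟, h𝔟mem⟩⟩ : (Ideal (𝓞 K))⁰) = ⟨_, hmem⟩ from rfl]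
    exact (ClassGroup.mk0_eq_one_iff hmem).mpr ⟨⟨_, h𝔟𝔟⟩⟩
  have hN2 := sq_eq_one_of_classGroupExtend_eq_one K hiN
  have hNp : classGroupNorm (maximalRealSubfield K) K (ClassGroup.mk0 ⟨𝔟, h𝔟mem⟩) ^ p = 1 := by
    rw [← map_pow, hxp, map_one]
  have hN1 : classGroupNorm (maximalRealSubfield K) K (ClassGroup.mk0 ⟨𝔟, h𝔟mem⟩) = 1 := by
    have h := Nat.dvd_gcd (orderOf_dvd_of_pow_eq_one hN2) (orderOf_dvd_of_pow_eq_one hNp)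
    rw [Nat.Coprime.gcd_eq_one ((Nat.coprime_primes Nat.prime_two hp).mpr hp2.symm),
      Nat.dvd_one] at h
    exact orderOf_eq_one_iff.mp h
  exact ⟨𝔟, c', h𝔟mem, h𝔟, h𝔟0, h𝔟𝔟, hkey, hN1, hxp⟩

end Radical

end Literature.NumberTheory.NumberFields

end
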